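import Literature.Analysis.FunctionSpaces.LatticeSobolevRellich
import Literature.Analysis.FunctionSpaces.TorusFourierModes
import HarnessLib

/-!
# Rellich's lemma `H² ⊂⊂ H¹` for smooth real vector fields on the flat torus, physical-space form

Analysis/FunctionSpaces support file (everything proved; no definitions, no named facts), the
companion one Sobolev level up of `TorusEnergyRellich.lean` (`H¹ ⊂⊂ L²` in `L²` / energy-space
form). It transports the lattice Rellich lemma `Lattice.rellich` (Warner 1983, Lemma 6.23: bounded
in `H_t` ⇒ a subsequence Cauchy in `H_s`, `s < t`; here `s = 1 < t = 2`) to SMOOTH real vector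
fields `v : T^d → ℝ^d` measured by the physical-space quantities of the fluid files,
`∫ ‖v‖²`, `Torus.gradNormSq v = ∫ ∑ᵢ ‖∂ᵢv‖²` and `∫ ‖Δv‖²`:

* `Torus.enorm_sq_mFourierCoeff_complexify_laplacian` — `‖𝓕(complexify ∘ Δv)(k)‖ₑ² = (4π²|k|²)² ‖v̂(k)‖ₑ²`;
* `Torus.sobolevWeight_two_sq_le` — `⟨k⟩⁴ = (1 + |k|²)² ≤ 2 + 2 (4π²|k|²)²`;
* `Torus.eNormSq_two_mFourierCoeff_complexify_le` — **the lattice `H_2` norm of the coefficients of a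
  smooth field is controlled by `‖v‖₂²` and `‖Δv‖₂²`**: `‖𝓕(complexify ∘ v)‖²_{H_2} ≤ 2‖v‖₂² + 2‖Δv‖₂²`
  (Parseval for `v` and for `Δv`);
* `Torus.eNormSq_one_mFourierCoeff_complexify_eq` — `‖𝓕(complexify ∘ v)‖²_{H_1} = ‖v‖₂² + (4π²)⁻¹‖∇v‖₂²`
  (`Torus.eSobolevNorm_one_complexify_sq`);
* `Torus.mFourierCoeff_complexify_sub` — linearity of the coefficients in the field;
* `Torus.exists_strictMono_h1Cauchy_of_integral_norm_laplacian_sq_le` — **Rellich `H² ⊂⊂ H¹`,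
  sequence form**: a sequence of smooth fields with `∫ ‖vₙ‖² ≤ B₀` and `∫ ‖Δvₙ‖² ≤ B₂` has a
  subsequence along which `∫ ‖v_{φm} − v_{φn}‖² + ‖∇(v_{φm} − v_{φn})‖₂² → 0`;
* `Torus.exists_strictMono_h1Cauchy_of_h2Energy_le` — the same from the single bound
  `∫ ‖vₙ‖² + ‖∇vₙ‖₂² + ∫ ‖Δvₙ‖² ≤ B`.

This is the compactness `D(A) ⊂⊂ V` behind the compactness of the derivative cocycle of the
Navier–Stokes semiflow on `V` (the linearised flow smooths `V → D(A)`, Constantin–Foias 1988 Ch. 14;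
Temam 1995 Ch. I §2.1: `H^{m+1}_per ↪ H^m_per` is compact). No intermediate `‖∇vₙ‖₂²` bound is
needed (interpolation), so the main theorem does not ask for one.

## Mathlib / tree search

Tree (reused): `Lattice.rellich`, `Lattice.eNormSq`, `Lattice.eNorm_pow_two` (`LatticeSobolev(Rellich)`),
`Torus.sobolevWeight_sq` (`LatticeSobolev`), `Torus.mFourierCoeff_complexify_laplacian` (`TorusFourierModes`),
`Torus.tsum_enorm_sq_mFourierCoeff_euclidean`, `Torus.eSobolevNorm_one_complexify_sq`,
`Torus.IsSmooth.complexify_comp` (`TorusFourierCalculus`), `Torus.mFourierCoeff_sub`,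
`Torus.complexify_comp_sub` (`TorusTrigPoly`), `Torus.integrable_complexify_comp` (`TorusVectorParseval`),
`EuclideanSpace.norm_complexify` (`Complexify`), `Torus.IsSmooth.laplacian/sub/integrable`. Searched
`rellich` / `eNormSq 2` / `exists_strictMono` on the torus side: `TorusEnergyRellich` (one level down,
`L²` classes), `Summits/…/MarginalStabilityChain…StubCompactSublevel` (`H_2 → H_0` for `L²` classes) and
`Summits/…/WindLineWindy…ToolsB` (`H_2 → H_1` for `ℓ²` coefficient families); no physical-space
`H² ⊂⊂ H¹` statement for smooth fields.

## References

* F. W. Warner, *Foundations of Differentiable Manifolds and Lie Groups*, GTM 94 (1983), Lemma 6.23.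
  [WarnerGTM94]
* R. Temam, *Navier–Stokes Equations and Nonlinear Functional Analysis*, 2nd ed., SIAM 1995, Ch. I §2.1.
* P. Constantin, C. Foias, *Navier–Stokes Equations*, Univ. Chicago Press 1988, Ch. 4, Ch. 14.
  [ConstantinFoiasNSE1988]
* L. Grafakos, *Classical Fourier Analysis*, 3rd ed., GTM 249 (2014), Prop. 3.2.6 (8), Prop. 3.2.7 (3).
  [Grafakos2014]
-/

noncomputable section

open _root_.MeasureTheory Set Filter Function UnitAddTorus
open scoped ENNReal NNReal Topology

namespace Literature.Analysis.FunctionSpaces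

namespace Torus

variable {d : Type*} [Fintype d] [DecidableEq d]

/-! ### The `H_2` and `H_1` lattice norms of the coefficients of a smooth real field -/

/-- **Fourier coefficients of the Laplacian, squared extended norms**:
`‖𝓕(complexify ∘ Δv)(k)‖ₑ² = (4π²|k|²)² ‖𝓕(complexify ∘ v)(k)‖ₑ²` for smooth `v : T^d → ℝ^d` (the symbol
`-4π²|k|²` of `Δ`, Grafakos 2014, Prop. 3.2.6 (8)). [cite: Grafakos2014, Prop. 3.2.6] -/
theorem enorm_sq_mFourierCoeff_complexify_laplacian {v : UnitAddTorus d → EuclideanSpace ℝ d}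
    (hv : IsSmooth v) (k : d → ℤ) :
    ‖mFourierCoeff (EuclideanSpace.complexify ∘ laplacian v) k‖ₑ ^ 2 =
      ENNReal.ofReal ((4 * Real.pi ^ 2 * freqNormSq k) ^ 2) *
        ‖mFourierCoeff (EuclideanSpace.complexify ∘ v) k‖ₑ ^ 2 := by
  have hr : 0 ≤ 4 * Real.pi ^ 2 * freqNormSq k := by
    have := freqNormSq_nonneg k
    positivity
  have h1 : ‖mFourierCoeff (EuclideanSpace.complexify ∘ laplacian v) k‖ₑ =
      ENNReal.ofReal (4 * Real.pi ^ 2 * freqNormSq k) *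
        ‖mFourierCoeff (EuclideanSpace.complexify ∘ v) k‖ₑ := by
    rw [mFourierCoeff_complexify_laplacian hv k, enorm_neg, enorm_smul, ← ofReal_norm (_ : ℂ),
      Complex.norm_of_nonneg hr]
  rw [h1, mul_pow, ← ENNReal.ofReal_pow hr]

omit [DecidableEq d] in
/-- The weight inequality behind `H_2 ≲ L² ∩ {‖Δ·‖₂ < ∞}`: `⟨k⟩⁴ = (1 + |k|²)² ≤ 2 + 2 (4π²|k|²)²`
(`(1 + r)² ≤ 2 + 2r²` and `4π² ≥ 1`). [folklore] -/
theorem sobolevWeight_two_sq_le (k : d → ℤ) :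
    sobolevWeight 2 k ^ 2 ≤ 2 + 2 * (4 * Real.pi ^ 2 * freqNormSq k) ^ 2 := by
  rw [sobolevWeight_sq, Real.rpow_two]
  have h0 := freqNormSq_nonneg k
  have hπ : (1 : ℝ) ≤ 4 * Real.pi ^ 2 := by nlinarith [Real.two_le_pi, Real.pi_pos]
  have h1 : freqNormSq k ≤ 4 * Real.pi ^ 2 * freqNormSq k := by
    simpa only [one_mul] using mul_le_mul_of_nonneg_right hπ h0
  nlinarith [sq_nonneg (1 - freqNormSq k), mul_le_mul h1 h1 h0 (h0.trans h1)]

/-- **The lattice `H_2` norm of the coefficients of a smooth real field**: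
`‖𝓕(complexify ∘ v)‖²_{H_2} ≤ 2 ∫ ‖v‖² + 2 ∫ ‖Δv‖²` (termwise `⟨k⟩⁴ ≤ 2 + 2(4π²|k|²)²`, the
Laplacian symbol, and Parseval for the smooth fields `v` and `Δv`, Grafakos 2014, Prop. 3.2.7 (3)).
[folklore] -/
theorem eNormSq_two_mFourierCoeff_complexify_le {v : UnitAddTorus d → EuclideanSpace ℝ d}
    (hv : IsSmooth v) :
    Lattice.eNormSq 2 (mFourierCoeff (EuclideanSpace.complexify ∘ v)) ≤
      2 * ENNReal.ofReal (∫ x, ‖v x‖ ^ 2) + 2 * ENNReal.ofReal (∫ x, ‖laplacian v x‖ ^ 2) := by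
  set c : (d → ℤ) → EuclideanSpace ℂ d := mFourierCoeff (EuclideanSpace.complexify ∘ v) with hc
  set cΔ : (d → ℤ) → EuclideanSpace ℂ d :=
    mFourierCoeff (EuclideanSpace.complexify ∘ laplacian v) with hcΔ
  have hterm : ∀ k, ENNReal.ofReal (sobolevWeight 2 k ^ 2) * ‖c k‖ₑ ^ 2 ≤
      2 * ‖c k‖ₑ ^ 2 + 2 * ‖cΔ k‖ₑ ^ 2 := fun k => by
    calc ENNReal.ofReal (sobolevWeight 2 k ^ 2) * ‖c k‖ₑ ^ 2
        ≤ ENNReal.ofReal (2 + 2 * (4 * Real.pi ^ 2 * freqNormSq k) ^ 2) * ‖c k‖ₑ ^ 2 := by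
          gcongr
          exact sobolevWeight_two_sq_le k
      _ = 2 * ‖c k‖ₑ ^ 2 + 2 * ‖cΔ k‖ₑ ^ 2 := by
          rw [hcΔ, enorm_sq_mFourierCoeff_complexify_laplacian hv k,
            ENNReal.ofReal_add zero_le_two (by positivity), ENNReal.ofReal_mul zero_le_two,
            ENNReal.ofReal_ofNat, add_mul, mul_assoc]
  have h0 : ∑' k, ‖c k‖ₑ ^ 2 = ENNReal.ofReal (∫ x, ‖v x‖ ^ 2) := by
    rw [hc, tsum_enorm_sq_mFourierCoeff_euclidean hv.complexify_comp.continuous]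
    simp only [Function.comp_apply, EuclideanSpace.norm_complexify]
  have h2 : ∑' k, ‖cΔ k‖ₑ ^ 2 = ENNReal.ofReal (∫ x, ‖laplacian v x‖ ^ 2) := by
    rw [hcΔ, tsum_enorm_sq_mFourierCoeff_euclidean hv.laplacian.complexify_comp.continuous]
    simp only [Function.comp_apply, EuclideanSpace.norm_complexify]
  calc Lattice.eNormSq 2 c = ∑' k, ENNReal.ofReal (sobolevWeight 2 k ^ 2) * ‖c k‖ₑ ^ 2 := rfl
    _ ≤ ∑' k, (2 * ‖c k‖ₑ ^ 2 + 2 * ‖cΔ k‖ₑ ^ 2) := ENNReal.tsum_le_tsum hterm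
    _ = 2 * ∑' k, ‖c k‖ₑ ^ 2 + 2 * ∑' k, ‖cΔ k‖ₑ ^ 2 := by
        rw [ENNReal.tsum_add, ENNReal.tsum_mul_left, ENNReal.tsum_mul_left]
    _ = 2 * ENNReal.ofReal (∫ x, ‖v x‖ ^ 2) + 2 * ENNReal.ofReal (∫ x, ‖laplacian v x‖ ^ 2) := by
        rw [h0, h2]

/-- **The lattice `H_1` norm of the coefficients of a smooth real field**:
`‖𝓕(complexify ∘ v)‖²_{H_1} = ∫ ‖v‖² + (4π²)⁻¹ ‖∇v‖₂²` (`⟨k⟩² = 1 + |k|²`; the identity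
`Torus.eSobolevNorm_one_complexify_sq` read through `Torus.eSobolevNorm_eq_eNorm`). [folklore] -/
theorem eNormSq_one_mFourierCoeff_complexify_eq {v : UnitAddTorus d → EuclideanSpace ℝ d}
    (hv : IsSmooth v) :
    Lattice.eNormSq 1 (mFourierCoeff (EuclideanSpace.complexify ∘ v)) =
      ENNReal.ofReal ((∫ x, ‖v x‖ ^ 2) + (4 * Real.pi ^ 2)⁻¹ * gradNormSq v) := by
  rw [← Lattice.eNorm_pow_two, ← eSobolevNorm_eq_eNorm, eSobolevNorm_one_complexify_sq hv]

omit [DecidableEq d] in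
/-- **Linearity of the coefficients of complexified real fields**:
`𝓕(complexify ∘ v) − 𝓕(complexify ∘ w) = 𝓕(complexify ∘ (v − w))` for integrable `v, w`
(`Torus.mFourierCoeff_sub` and `Torus.complexify_comp_sub`). [folklore] -/
theorem mFourierCoeff_complexify_sub {v w : UnitAddTorus d → EuclideanSpace ℝ d}
    (hv : Integrable v volume) (hw : Integrable w volume) :
    mFourierCoeff (EuclideanSpace.complexify ∘ v) - mFourierCoeff (EuclideanSpace.complexify ∘ w) =
      mFourierCoeff (EuclideanSpace.complexify ∘ (v - w)) := by
  funext k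
  rw [Pi.sub_apply, ← mFourierCoeff_sub (integrable_complexify_comp hv) (integrable_complexify_comp hw) k,
    complexify_comp_sub]

/-! ### Rellich's lemma `H² ⊂⊂ H¹` for smooth real vector fields -/

/-- **Rellich's lemma `H² ⊂⊂ H¹` on `T^d`, sequence form in physical space** (Warner 1983, Lemma 6.23,
`s = 1 < t = 2`, transported from the lattice by Parseval): a sequence `(vₙ)` of smooth real vector
fields on `T^d` with `∫ ‖vₙ‖² ≤ B₀` and `∫ ‖Δvₙ‖² ≤ B₂` has a subsequence `v ∘ φ` which is Cauchy in
`H¹`: for every `ε > 0`, `∫ ‖v_{φm} − v_{φn}‖² + ‖∇(v_{φm} − v_{φn})‖₂² < ε` for all large `m, n`.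
Proof: the coefficient families `𝓕(complexify ∘ vₙ)` are bounded in the lattice norm `H_2`
(`eNormSq_two_mFourierCoeff_complexify_le`), `Lattice.rellich` gives a subsequence Cauchy in `H_1`,
and `H_1`-distances of coefficients dominate `(4π²)⁻¹ ×` the `H¹`-distances of the fields
(`mFourierCoeff_complexify_sub`, `eNormSq_one_mFourierCoeff_complexify_eq`, `4π² ≥ 1`). No bound on
`‖∇vₙ‖₂²` is needed. [cite: WarnerGTM94, Lemma 6.23] -/
theorem exists_strictMono_h1Cauchy_of_integral_norm_laplacian_sq_le
    {v : ℕ → UnitAddTorus d → EuclideanSpace ℝ d} (hv : ∀ n, IsSmooth (v n)) {B₀ B₂ : ℝ}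
    (h0 : ∀ n, ∫ x, ‖v n x‖ ^ 2 ≤ B₀) (h2 : ∀ n, ∫ x, ‖laplacian (v n) x‖ ^ 2 ≤ B₂) :
    ∃ φ : ℕ → ℕ, StrictMono φ ∧ ∀ ε : ℝ, 0 < ε → ∃ N : ℕ, ∀ m n : ℕ, N ≤ m → N ≤ n →
      (∫ x, ‖v (φ m) x - v (φ n) x‖ ^ 2) + gradNormSq (v (φ m) - v (φ n)) < ε := by
  set c : ℕ → (d → ℤ) → EuclideanSpace ℂ d := fun n =>
    mFourierCoeff (EuclideanSpace.complexify ∘ v n) with hc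
  have hRtop : 2 * ENNReal.ofReal B₀ + 2 * ENNReal.ofReal B₂ ≠ ∞ := ENNReal.add_ne_top.2
    ⟨ENNReal.mul_ne_top ENNReal.ofNat_ne_top ENNReal.ofReal_ne_top,
      ENNReal.mul_ne_top ENNReal.ofNat_ne_top ENNReal.ofReal_ne_top⟩
  have hbound : ∀ n, Lattice.eNormSq 2 (c n) ≤ 2 * ENNReal.ofReal B₀ + 2 * ENNReal.ofReal B₂ := fun n =>
    calc Lattice.eNormSq 2 (c n)
        ≤ 2 * ENNReal.ofReal (∫ x, ‖v n x‖ ^ 2) + 2 * ENNReal.ofReal (∫ x, ‖laplacian (v n) x‖ ^ 2) :=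
          eNormSq_two_mFourierCoeff_complexify_le (hv n)
      _ ≤ 2 * ENNReal.ofReal B₀ + 2 * ENNReal.ofReal B₂ := by
          gcongr
          · exact h0 n
          · exact h2 n
  obtain ⟨φ, hφ, hC⟩ :=
    Lattice.rellich (V := EuclideanSpace ℂ d) (s := (1 : ℝ)) (t := 2) one_lt_two hRtop hbound
  refine ⟨φ, hφ, fun ε hε => ?_⟩
  have h4π : 0 < 4 * Real.pi ^ 2 := by positivity
  have h1π : (1 : ℝ) ≤ 4 * Real.pi ^ 2 := by nlinarith [Real.two_le_pi, Real.pi_pos]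
  obtain ⟨N, hN⟩ := hC (ENNReal.ofReal (ε / (8 * Real.pi ^ 2))) (ENNReal.ofReal_pos.2 (by positivity))
  refine ⟨N, fun m n hm hn => ?_⟩
  have hsm : IsSmooth (v (φ m) - v (φ n)) := (hv _).sub (hv _)
  have h := hN m n hm hn
  have hcm : c (φ m) - c (φ n) = mFourierCoeff (EuclideanSpace.complexify ∘ (v (φ m) - v (φ n))) :=
    mFourierCoeff_complexify_sub (hv _).integrable (hv _).integrable
  rw [hcm, eNormSq_one_mFourierCoeff_complexify_eq hsm,
    ENNReal.ofReal_le_ofReal_iff (by positivity)] at h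
  have hI : 0 ≤ ∫ x, ‖(v (φ m) - v (φ n)) x‖ ^ 2 := integral_nonneg fun _ => sq_nonneg _
  show (∫ x, ‖(v (φ m) - v (φ n)) x‖ ^ 2) + gradNormSq (v (φ m) - v (φ n)) < ε
  calc (∫ x, ‖(v (φ m) - v (φ n)) x‖ ^ 2) + gradNormSq (v (φ m) - v (φ n))
      ≤ 4 * Real.pi ^ 2 * (∫ x, ‖(v (φ m) - v (φ n)) x‖ ^ 2) + gradNormSq (v (φ m) - v (φ n)) := by
        nlinarith
    _ = 4 * Real.pi ^ 2 * ((∫ x, ‖(v (φ m) - v (φ n)) x‖ ^ 2) +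
          (4 * Real.pi ^ 2)⁻¹ * gradNormSq (v (φ m) - v (φ n))) := by
        field_simp
    _ ≤ 4 * Real.pi ^ 2 * (ε / (8 * Real.pi ^ 2)) := mul_le_mul_of_nonneg_left h h4π.le
    _ = ε / 2 := by
        field_simp
        ring
    _ < ε := half_lt_self hε

/-- **Rellich's lemma `H² ⊂⊂ H¹` on `T^d`, single-budget form**: a sequence `(vₙ)` of smooth real
vector fields with `∫ ‖vₙ‖² + ‖∇vₙ‖₂² + ∫ ‖Δvₙ‖² ≤ B` has a subsequence `v ∘ φ` which is Cauchy in
`H¹` (`∫ ‖v_{φm} − v_{φn}‖² + ‖∇(v_{φm} − v_{φn})‖₂² < ε` for all large `m, n`). Immediate from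
`exists_strictMono_h1Cauchy_of_integral_norm_laplacian_sq_le`, all three summands being non-negative.
This is the shape consumed by the compactness of the linearised Navier–Stokes flow `V → V` over a
time window (`L²`/`H¹` growth and `V → H²` smoothing bounds at the final time).
[cite: WarnerGTM94, Lemma 6.23] -/
theorem exists_strictMono_h1Cauchy_of_h2Energy_le
    {v : ℕ → UnitAddTorus d → EuclideanSpace ℝ d} (hv : ∀ n, IsSmooth (v n)) {B : ℝ}
    (hB : ∀ n, (∫ x, ‖v n x‖ ^ 2) + gradNormSq (v n) + ∫ x, ‖laplacian (v n) x‖ ^ 2 ≤ B) :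
    ∃ φ : ℕ → ℕ, StrictMono φ ∧ ∀ ε : ℝ, 0 < ε → ∃ N : ℕ, ∀ m n : ℕ, N ≤ m → N ≤ n →
      (∫ x, ‖v (φ m) x - v (φ n) x‖ ^ 2) + gradNormSq (v (φ m) - v (φ n)) < ε := by
  have hI : ∀ n, 0 ≤ ∫ x, ‖v n x‖ ^ 2 := fun n => integral_nonneg fun _ => sq_nonneg _
  have hL : ∀ n, 0 ≤ ∫ x, ‖laplacian (v n) x‖ ^ 2 := fun n => integral_nonneg fun _ => sq_nonneg _
  refine exists_strictMono_h1Cauchy_of_integral_norm_laplacian_sq_le hv (B₀ := B) (B₂ := B)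
    (fun n => ?_) (fun n => ?_)
  · linarith [hB n, hL n, gradNormSq_nonneg (v n)]
  · linarith [hB n, hI n, gradNormSq_nonneg (v n)]

end Torus

end Literature.Analysis.FunctionSpaces

end
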